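import Mathlib.Analysis.Calculus.BumpFunction.Normed
import Mathlib.Analysis.Calculus.BumpFunction.FiniteDimension
import Mathlib.MeasureTheory.Measure.Haar.NormedSpace
import Literature.Analysis.FunctionSpaces.FlatTorusProofs
import HarnessLib

/-!
# Smooth kernels on the flat torus `T^d`: the standard mollifier

Analysis/FunctionSpaces support file (serves the discharge of the DiPerna–Lions uniqueness fact
`Literature.Analysis.FluidPDE.Torus.IsWeakScalarTransportOn.unique_of_lipschitz`, `FluidPDE/PassiveScalar`, whose proof
regularises a weak solution in space by convolution with smooth kernels on `T^d`;
DiPerna–Lions 1989, §II.1, proof of Thm. II.1). The convolution/mollification theorems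
themselves (`θ ⋆ kernel ε` is smooth, derivative formulas, Young's inequality, `L²` convergence)
are developed in the follow-up file `Literature.Analysis.FunctionSpaces.TorusConvolution`.

Mathlib's bump functions (`ContDiffBump`) live on finite-dimensional real normed spaces; the
torus `UnitAddTorus d = d → AddCircle 1` is a compact abelian *group* with Haar probability
measure `volume` but not a vector space, and the tree expresses smoothness on it through the
periodic lift (`Torus.IsSmooth f := ContDiff ℝ ∞ (lift f)`, `FlatTorus`). This file transplants
compactly supported Euclidean kernels to the torus:

* `Torus.reprc : T^d → ℝ^d` — the representative in the *centred* fundamental domain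
  `[-1/2, 1/2)^d` (a section of `proj`, measure preserving onto the centred cube, and
  `‖z‖ ≤ ‖reprc z‖`: the quotient (sup) norm of the torus is dominated by the Euclidean norm of
  the representative);
* `Torus.transplant ρ : T^d → F`, `z ↦ ρ (reprc z)` — for a profile `ρ : ℝ^d → F` supported in
  the ball `B(0, 1/4)` this is the periodisation of `ρ` (one lattice translate at a time), and
  its lift agrees with `ρ` near every representative (`lift_transplant_eventuallyEq`); hence
  `transplant ρ` is smooth when `ρ` is, with `D (transplant ρ) z = Dρ (reprc z)`,
  `∇(transplant ρ) z = ∇ρ (reprc z)`, `Δ (transplant ρ) z = Δρ (reprc z)`, and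
  `∫_{T^d} g ∘ reprc = ∫_{ℝ^d} g` for `g` supported in `B(0, 1/2)`;
* `Torus.profile ε`, `Torus.kernel ε = transplant (profile ε)` — the standard mollifier
  `ρ_ε(v) = ε^{-d} ρ₁(v/ε)` (`ρ₁` a normalised bump supported in `B(0,1)`) and its torus version,
  for `0 < ε ≤ 1/4`: smooth, nonnegative, unit mass, supported in `{‖z‖ < ε}`, with
  `∫_{T^d} ‖∇ kernel ε‖ = C₁ / ε` (`C₁ = ∫ ‖Dρ₁‖`);

## Notes for the librarian (duplicates blocked by layering)

* `Torus.reprSym` (`Literature/Analysis/FluidPDE/HardSpherePhaseSpace.lean`, same namespace)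
  is already a centred section of `proj`, with values in `(-1/2, 1/2]^d` (coordinatewise
  `AddCircle.equivIoc 1 (-1/2)`), and `proj_reprSym`, `abs_reprSym_apply`,
  `measurable_reprSym`; its `norm_reprSym_le` is an undischarged named fact. The present
  `Torus.reprc` uses `[-1/2, 1/2)^d` and is *defined from* `Torus.repr` by a translation, so
  that measure preservation (`measurePreserving_repr`) and the section property on the cube
  (`repr_proj_of_mem_unitCube_holds`) are inherited for free; the two agree coordinatewise up to
  the endpoint convention and `‖reprc z‖ = ‖reprSym z‖`. `FunctionSpaces/` must not import
  `FluidPDE/`, so they are not unified here; `reprc`'s API is the superset and the two should be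
  merged when `HardSpherePhaseSpace` is re-based.
* `Torus.profile ε` is byte-for-byte `Fluid.mollifierScale ε (Torus.profileOne d)` of
  `Literature/Analysis/FluidPDE/DissipationAnomaly.lean` (which also proves
  `integral_mollifierScale`, the analogue of `integral_profile`); again not importable here.
  `Fluid.mollifierScale` / `Fluid.IsMollifier` belong in `FunctionSpaces/`.

## References

* R. J. DiPerna, P.-L. Lions, *Ordinary differential equations, transport theory and Sobolev
  spaces*, Invent. Math. 98 (1989), 511–547, §II.1 (regularisation `ρ_ε ⋆ u`).
* L. C. Evans, *Partial Differential Equations*, 2nd ed. (AMS 2010), App. C.4, Thm. 7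
  (properties of mollifiers).
* L. Grafakos, *Classical Fourier Analysis*, 3rd ed. (2014), §3.1.1 (`T^n = ℝ^n/ℤ^n`, the
  fundamental domain `[-1/2, 1/2)^n`, `1`-periodic functions).
-/

noncomputable section

open MeasureTheory TopologicalSpace Set Function Filter Topology Metric ContinuousLinearMap
open scoped ENNReal NNReal Convolution ContDiff InnerProductSpace Laplacian

namespace Literature.Analysis.FunctionSpaces

namespace Torus

variable {d : Type*} [Fintype d]
variable {F : Type*} [NormedAddCommGroup F] [NormedSpace ℝ F]

/-! ## Norms: the torus (quotient, sup) norm against the Euclidean norm of representatives -/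

section Norms

/-- A coordinate of a Euclidean vector is bounded by its norm: `|v i| ≤ ‖v‖`. [folklore] -/
theorem abs_apply_le_norm (v : EuclideanSpace ℝ d) (i : d) : |v i| ≤ ‖v‖ := by
  simpa using PiLp.norm_apply_le v i

/-- The quotient map `ℝ^d → T^d` is norm-non-increasing: `‖proj v‖ ≤ ‖v‖` (the torus carries
the sup of the quotient norms of `AddCircle 1`, each `≤ |v i| ≤ ‖v‖`). [folklore] -/
theorem norm_proj_le (v : EuclideanSpace ℝ d) : ‖proj v‖ ≤ ‖v‖ := by
  rw [pi_norm_le_iff_of_nonneg (norm_nonneg _)]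
  intro i
  have h := QuotientAddGroup.norm_mk_le_norm (S := AddSubgroup.zmultiples (1 : ℝ)) (m := v i)
  exact (by simpa using h : ‖((v i : ℝ) : UnitAddCircle)‖ ≤ ‖v i‖).trans
    (by simpa [Real.norm_eq_abs] using abs_apply_le_norm v i)

/-- `dist (x - proj v) x ≤ ‖v‖` on the torus. [folklore] -/
theorem dist_sub_proj_le (x : UnitAddTorus d) (v : EuclideanSpace ℝ d) :
    dist (x - proj v) x ≤ ‖v‖ := by
  rw [dist_eq_norm, sub_sub_cancel_left, norm_neg]
  exact norm_proj_le v

/-- The torus has diameter at most `1/2` in the quotient sup norm: `‖z‖ ≤ 1/2`. [folklore] -/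
theorem norm_le_half (z : UnitAddTorus d) : ‖z‖ ≤ 1 / 2 := by
  rw [pi_norm_le_iff_of_nonneg (by norm_num)]
  intro i
  simpa using AddCircle.norm_le_half_period (1 : ℝ) (x := z i) one_ne_zero

/-- `dist x y ≤ 1/2` on the torus. [folklore] -/
theorem dist_le_half (x y : UnitAddTorus d) : dist x y ≤ 1 / 2 := by
  rw [dist_eq_norm]
  exact norm_le_half _

end Norms

/-! ## The centred fundamental domain `[-1/2, 1/2)^d` and its representative map -/

section Reprc

/-- The centre `(1/2, …, 1/2)` of the unit cube `[0,1)^d`. [folklore] -/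
def cubeCenter (d : Type*) : EuclideanSpace ℝ d := WithLp.toLp 2 fun _ => (1 / 2 : ℝ)

omit [Fintype d] in
/-- Coordinates of the centre of the unit cube. [folklore] -/
@[simp]
theorem cubeCenter_apply (i : d) : cubeCenter d i = 1 / 2 := rfl

/-- The centred half-open cube `[-1/2, 1/2)^d ⊂ ℝ^d`, a fundamental domain for `ℤ^d`
(Grafakos, §3.1.1). [folklore] -/
def centredCube (d : Type*) : Set (EuclideanSpace ℝ d) :=
  {v | ∀ i, v i ∈ Ico (-(1 / 2) : ℝ) (1 / 2)}

omit [Fintype d] in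
/-- Membership in the centred cube. [folklore] -/
@[simp]
theorem mem_centredCube {v : EuclideanSpace ℝ d} :
    v ∈ centredCube d ↔ ∀ i, v i ∈ Ico (-(1 / 2) : ℝ) (1 / 2) :=
  Iff.rfl

/-- The centred cube is measurable. [folklore] -/
theorem measurableSet_centredCube : MeasurableSet (centredCube d) := by
  have : centredCube d = ⋂ i, (fun v : EuclideanSpace ℝ d => v i) ⁻¹' Ico (-(1 / 2)) (1 / 2) := by
    ext v
    simp
  rw [this]
  exact MeasurableSet.iInter fun i => measurableSet_Ico.preimage (by fun_prop)

omit [Fintype d] in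
/-- The centred cube is the translate of the unit cube by `-(1/2, …, 1/2)`. [folklore] -/
theorem sub_cubeCenter_mem_centredCube_iff (w : EuclideanSpace ℝ d) :
    w - cubeCenter d ∈ centredCube d ↔ w ∈ unitCube d := by
  simp only [mem_centredCube, mem_unitCube, PiLp.sub_apply, cubeCenter_apply, mem_Ico]
  refine forall_congr' fun i => ?_
  constructor <;> rintro ⟨h1, h2⟩ <;> constructor <;> linarith

/-- The representative of a point of `T^d` in the centred fundamental domain `[-1/2, 1/2)^d`:
translate by `proj (1/2, …, 1/2)`, take the representative in `[0,1)^d` (`Torus.repr`) and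
translate back (Grafakos, §3.1.1: `T^n` may be identified with any fundamental cube, here the
centred one, so that `0 ∈ T^d` is represented by `0 ∈ ℝ^d` and small balls around `0` are not cut
by the identifications). **Relation to `Torus.reprSym`** (`FluidPDE/HardSpherePhaseSpace`): that
is the `(-1/2, 1/2]^d`-valued section built coordinatewise from `AddCircle.equivIoc`; a second
section is introduced here (rather than imported: `FunctionSpaces/` may not import `FluidPDE/`)
and built from `Torus.repr`, so that `measurePreserving_repr` and
`repr_proj_of_mem_unitCube_holds` transfer by a translation (`measurePreserving_reprc`,
`reprc_proj_of_mem_centredCube`); see the module docstring's note for the librarian. [folklore] -/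
def reprc (z : UnitAddTorus d) : EuclideanSpace ℝ d := repr (z + proj (cubeCenter d)) - cubeCenter d

omit [Fintype d] in
/-- `reprc` is a section of the covering map: `proj (reprc z) = z`. [folklore] -/
@[simp]
theorem proj_reprc (z : UnitAddTorus d) : proj (reprc z) = z := by
  rw [reprc, show ∀ a b : EuclideanSpace ℝ d, proj (a - b) = proj a - proj b from fun _ _ => rfl,
    proj_repr, add_sub_cancel_right]

omit [Fintype d] in
/-- The coordinates of the centred representative lie in `[-1/2, 1/2)`. [folklore] -/
theorem reprc_apply_mem_Ico (z : UnitAddTorus d) (i : d) :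
    reprc z i ∈ Ico (-(1 / 2) : ℝ) (1 / 2) := by
  have h := repr_apply_mem_Ico (z + proj (cubeCenter d)) i
  simp only [reprc, PiLp.sub_apply, cubeCenter_apply, mem_Ico] at h ⊢
  constructor <;> linarith [h.1, h.2]

omit [Fintype d] in
/-- The centred representative lies in the centred cube. [folklore] -/
theorem reprc_mem_centredCube (z : UnitAddTorus d) : reprc z ∈ centredCube d :=
  fun i => reprc_apply_mem_Ico z i

omit [Fintype d] in
/-- `|reprc z i| ≤ 1/2`. [folklore] -/
theorem abs_reprc_apply_le (z : UnitAddTorus d) (i : d) : |reprc z i| ≤ 1 / 2 := by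
  have h := reprc_apply_mem_Ico z i
  rw [abs_le]
  exact ⟨h.1, h.2.le⟩

/-- `reprc` is measurable. [folklore] -/
theorem measurable_reprc : Measurable (reprc : UnitAddTorus d → EuclideanSpace ℝ d) :=
  (measurable_repr.comp (measurable_id.add_const _)).sub_const _

/-- The torus norm is dominated by the Euclidean norm of the centred representative:
`‖z‖ ≤ ‖reprc z‖` (`z = proj (reprc z)` and `‖proj v‖ ≤ ‖v‖`). [folklore] -/
theorem norm_le_norm_reprc (z : UnitAddTorus d) : ‖z‖ ≤ ‖reprc z‖ := by
  conv_lhs => rw [← proj_reprc z]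
  exact norm_proj_le _

omit [Fintype d] in
/-- On the centred cube, `reprc ∘ proj` is the identity. [folklore] -/
theorem reprc_proj_of_mem_centredCube {v : EuclideanSpace ℝ d} (hv : v ∈ centredCube d) :
    reprc (proj v) = v := by
  have h : v + cubeCenter d ∈ unitCube d := by
    rw [← sub_cubeCenter_mem_centredCube_iff, add_sub_cancel_right]
    exact hv
  rw [reprc, ← proj_add, repr_proj_of_mem_unitCube_holds h, add_sub_cancel_right]

/-- Vectors of norm `< 1/2` are their own centred representatives: `reprc (proj v) = v`. [folklore] -/
theorem reprc_proj_of_norm_lt {v : EuclideanSpace ℝ d} (hv : ‖v‖ < 1 / 2) : reprc (proj v) = v := by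
  refine reprc_proj_of_mem_centredCube fun i => ?_
  have h := (abs_apply_le_norm v i).trans_lt hv
  rw [abs_lt] at h
  exact ⟨h.1.le, h.2⟩

/-- **`reprc` is measure preserving** from `volume` on `T^d` onto Lebesgue measure on the centred
cube: it is the composition of the translation by `proj (1/2,…,1/2)` (Haar measure), the
section `repr` (measure preserving onto the unit cube, `measurePreserving_repr`) and the
translation by `-(1/2,…,1/2)` of `ℝ^d` (Lebesgue measure), which carries `[0,1)^d` onto
`[-1/2,1/2)^d` (Grafakos, §3.1.1). [folklore] -/
theorem measurePreserving_reprc :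
    MeasurePreserving (reprc : UnitAddTorus d → EuclideanSpace ℝ d) volume
      (volume.restrict (centredCube d)) := by
  have h1 : MeasurePreserving (fun z : UnitAddTorus d => z + proj (cubeCenter d)) volume volume :=
    measurePreserving_add_right volume _
  have h2 := measurePreserving_repr (d := d)
  have h3 : MeasurePreserving (fun w : EuclideanSpace ℝ d => w - cubeCenter d)
      (volume.restrict (unitCube d)) (volume.restrict (centredCube d)) := by
    have h := (measurePreserving_sub_right (volume : Measure (EuclideanSpace ℝ d))
      (cubeCenter d)).restrict_preimage (measurableSet_centredCube (d := d))
    have hpre : (fun w : EuclideanSpace ℝ d => w - cubeCenter d) ⁻¹' centredCube d = unitCube d := by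
      ext w
      exact sub_cubeCenter_mem_centredCube_iff w
    rwa [hpre] at h
  exact h3.comp (h2.comp h1)

omit [Fintype d] in
/-- The range of `reprc` is the centred cube. [folklore] -/
theorem range_reprc : range (reprc : UnitAddTorus d → EuclideanSpace ℝ d) = centredCube d := by
  refine Subset.antisymm ?_ fun v hv => ⟨proj v, reprc_proj_of_mem_centredCube hv⟩
  rintro _ ⟨z, rfl⟩
  exact reprc_mem_centredCube z

/-- `reprc` is a measurable embedding (it has the measurable left inverse `proj`). [folklore] -/
theorem measurableEmbedding_reprc :
    MeasurableEmbedding (reprc : UnitAddTorus d → EuclideanSpace ℝ d) :=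
  MeasurableEmbedding.of_measurable_inverse measurable_reprc
    (by rw [range_reprc]; exact measurableSet_centredCube) measurable_proj proj_reprc

/-- Integration over `T^d` through the centred fundamental domain:
`∫_{T^d} g (reprc z) dz = ∫_{[-1/2,1/2)^d} g` (Grafakos, §3.1.1). [folklore] -/
theorem integral_comp_reprc (g : EuclideanSpace ℝ d → F) :
    ∫ z, g (reprc z) = ∫ v in centredCube d, g v :=
  (measurePreserving_reprc (d := d)).integral_comp measurableEmbedding_reprc g

/-- Lower Lebesgue integral over `T^d` through the centred fundamental domain. [folklore] -/
theorem lintegral_comp_reprc (g : EuclideanSpace ℝ d → ℝ≥0∞) :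
    ∫⁻ z, g (reprc z) = ∫⁻ v in centredCube d, g v :=
  (measurePreserving_reprc (d := d)).lintegral_comp_emb measurableEmbedding_reprc g

/-- The ball `B(0, 1/2)` lies in the centred cube. [folklore] -/
theorem ball_half_subset_centredCube : ball (0 : EuclideanSpace ℝ d) (1 / 2) ⊆ centredCube d := by
  intro v hv i
  have h := (abs_apply_le_norm v i).trans_lt (mem_ball_zero_iff.1 hv)
  rw [abs_lt] at h
  exact ⟨h.1.le, h.2⟩

/-- For `g` supported in `B(0, 1/2)`: `∫_{T^d} g (reprc z) dz = ∫_{ℝ^d} g`. [folklore] -/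
theorem integral_comp_reprc_of_support_subset {g : EuclideanSpace ℝ d → F}
    (hg : support g ⊆ ball 0 (1 / 2)) : ∫ z, g (reprc z) = ∫ v, g v := by
  rw [integral_comp_reprc, setIntegral_eq_integral_of_forall_compl_eq_zero]
  exact fun v hv => notMem_support.1 fun h => hv (ball_half_subset_centredCube (hg h))

/-- For `g` supported in `B(0, 1/2)`: `∫⁻_{T^d} g (reprc z) dz = ∫⁻_{ℝ^d} g`. [folklore] -/
theorem lintegral_comp_reprc_of_support_subset {g : EuclideanSpace ℝ d → ℝ≥0∞}
    (hg : support g ⊆ ball 0 (1 / 2)) : ∫⁻ z, g (reprc z) = ∫⁻ v, g v := by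
  rw [lintegral_comp_reprc, setLIntegral_eq_of_support_subset]
  exact hg.trans ball_half_subset_centredCube

end Reprc

/-! ## Transplanting Euclidean profiles with small support to the torus -/

section Transplant

variable {F' : Type*}

/-- The transplant `z ↦ ρ (reprc z)` to `T^d` of a profile `ρ : ℝ^d → F'`. For `ρ` supported in
`B(0, 1/4)` this is the periodisation `∑_{k ∈ ℤ^d} ρ(y + k)` read on the torus (at most one
non-zero term), i.e. the standard way of placing a bump "at `0 ∈ T^d`" (Grafakos, §3.1.1;
DiPerna–Lions 1989, §II.1, the kernels `ρ_ε`). [folklore] -/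
def transplant (ρ : EuclideanSpace ℝ d → F') (z : UnitAddTorus d) : F' := ρ (reprc z)

omit [Fintype d] in
/-- `transplant ρ z = ρ (reprc z)`. [folklore] -/
@[simp]
theorem transplant_apply [Fintype d] (ρ : EuclideanSpace ℝ d → F') (z : UnitAddTorus d) :
    transplant ρ z = ρ (reprc z) := rfl

/-- Near the origin the transplant is the profile: `transplant ρ (proj v) = ρ v` for
`‖v‖ < 1/2`. [folklore] -/
theorem transplant_proj_of_norm_lt (ρ : EuclideanSpace ℝ d → F') {v : EuclideanSpace ℝ d}
    (hv : ‖v‖ < 1 / 2) : transplant ρ (proj v) = ρ v := by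
  rw [transplant_apply, reprc_proj_of_norm_lt hv]

omit [Fintype d] in
/-- Two representatives of the same point of `T^d` differ by a vector with integer coordinates. [folklore] -/
theorem exists_int_eq_sub_of_proj_eq {v w : EuclideanSpace ℝ d} (h : proj v = proj w) (i : d) :
    ∃ n : ℤ, (n : ℝ) = v i - w i := by
  have hi : ((v i : ℝ) : UnitAddCircle) = ((w i : ℝ) : UnitAddCircle) := congrFun h i
  have h0 : ((v i - w i : ℝ) : UnitAddCircle) = 0 := by
    rw [AddCircle.coe_sub, hi, sub_self]
  obtain ⟨n, hn⟩ := (AddCircle.coe_eq_zero_iff (1 : ℝ)).1 h0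
  exact ⟨n, by simpa using hn⟩

variable [Zero F']

/-- **The transplant is locally a lattice translate of the profile.** If `ρ` is supported in
`B(0, 1/4)`, then near every `y₀ ∈ ℝ^d` the lift `y ↦ transplant ρ (proj y)` coincides with the
translate `y ↦ ρ (y - m)`, `m = y₀ - reprc (proj y₀) ∈ ℤ^d`: on `B(y₀, 1/4)` either the centred
representative of `proj y` *is* `y - m`, or both `reprc (proj y)` and `y - m` have a coordinate
of modulus `≥ 1/4` and `ρ` vanishes at both (Grafakos, §3.1.1: a `1`-periodic function is
determined by its values on a fundamental cube). [folklore] -/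
theorem transplant_proj_eventuallyEq {ρ : EuclideanSpace ℝ d → F'} (hρ : support ρ ⊆ ball 0 (1 / 4))
    (y₀ : EuclideanSpace ℝ d) :
    (fun y => transplant ρ (proj y)) =ᶠ[𝓝 y₀] fun y => ρ (y - (y₀ - reprc (proj y₀))) := by
  have hρ' : ∀ v : EuclideanSpace ℝ d, (∃ i, 1 / 4 ≤ |v i|) → ρ v = 0 := by
    rintro v ⟨i, hi⟩
    refine notMem_support.1 fun h => ?_
    have h' := mem_ball_zero_iff.1 (hρ h)
    linarith [abs_apply_le_norm v i]
  filter_upwards [ball_mem_nhds y₀ (by norm_num : (0 : ℝ) < 1 / 4)] with y hy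
  set w₀ := reprc (proj y₀) with hw₀
  set w := reprc (proj y) with hw
  simp only [transplant_apply]
  rw [← hw]
  -- `w - (y - (y₀ - w₀))` has integer coordinates
  have hproj : proj w = proj (y - (y₀ - w₀)) := by
    rw [hw, proj_reprc,
      show ∀ a b : EuclideanSpace ℝ d, proj (a - b) = proj a - proj b from fun _ _ => rfl,
      show ∀ a b : EuclideanSpace ℝ d, proj (a - b) = proj a - proj b from fun _ _ => rfl,
      hw₀, proj_reprc, sub_self, sub_zero]
  by_cases heq : w = y - (y₀ - w₀)
  · rw [heq]
  · -- some coordinate differs, by a non-zero integer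
    have hne : ∃ i, w i ≠ (y - (y₀ - w₀)) i := by
      by_contra hall
      exact heq (PiLp.ext fun i => not_not.1 (not_exists.1 hall i))
    obtain ⟨i, hi⟩ := hne
    obtain ⟨n, hn⟩ := exists_int_eq_sub_of_proj_eq hproj i
    have hn0 : n ≠ 0 := by
      rintro rfl
      exact hi (by simpa [sub_eq_zero] using hn.symm)
    have hn1 : (1 : ℝ) ≤ |(n : ℝ)| := by
      rw [← Int.cast_abs]
      exact_mod_cast Int.one_le_abs hn0
    have hwi := reprc_apply_mem_Ico (proj y) i
    have hw₀i := reprc_apply_mem_Ico (proj y₀) i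
    rw [← hw] at hwi
    rw [← hw₀] at hw₀i
    have hyi : |(y - y₀) i| < 1 / 4 :=
      (abs_apply_le_norm (y - y₀) i).trans_lt (by simpa [dist_eq_norm] using hy)
    simp only [PiLp.sub_apply, mem_Ico] at hn hwi hw₀i hyi
    rw [abs_lt] at hyi
    -- both values vanish
    have hw1 : 1 / 4 ≤ |w i| := by
      rcases le_or_gt 0 (n : ℝ) with hn' | hn'
      · rw [abs_of_nonneg hn'] at hn1
        rw [le_abs]
        left
        linarith
      · rw [abs_of_neg hn'] at hn1
        rw [le_abs]
        right
        linarith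
    have hy1 : 1 / 4 ≤ |(y - (y₀ - w₀)) i| := by
      simp only [PiLp.sub_apply]
      rcases le_or_gt 0 (n : ℝ) with hn' | hn'
      · rw [abs_of_nonneg hn'] at hn1
        rw [le_abs]
        right
        linarith
      · rw [abs_of_neg hn'] at hn1
        rw [le_abs]
        left
        linarith
    rw [hρ' w ⟨i, hw1⟩, hρ' (y - (y₀ - w₀)) ⟨i, hy1⟩]

/-- Near a centred representative the lift of the transplant *is* the profile:
`lift (transplant ρ) = ρ` near `reprc z` (the case `y₀ = reprc z`, `m = 0`, of
`transplant_proj_eventuallyEq`). [folklore] -/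
theorem lift_transplant_eventuallyEq {ρ : EuclideanSpace ℝ d → F'} (hρ : support ρ ⊆ ball 0 (1 / 4))
    (z : UnitAddTorus d) : lift (transplant ρ) =ᶠ[𝓝 (reprc z)] ρ := by
  have h := transplant_proj_eventuallyEq hρ (reprc z)
  simp only [proj_reprc, sub_self, sub_zero] at h
  exact h

/-- Outside the support radius the transplant vanishes: if `support ρ ⊆ B(0, r)` and
`r ≤ ‖reprc z‖` then `transplant ρ z = 0`. [folklore] -/
theorem transplant_eq_zero_of_le {ρ : EuclideanSpace ℝ d → F'} {r : ℝ} (hρ : support ρ ⊆ ball 0 r)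
    {z : UnitAddTorus d} (hz : r ≤ ‖reprc z‖) : transplant ρ z = 0 :=
  notMem_support.1 fun h => (mem_ball_zero_iff.1 (hρ h)).not_ge hz

/-- The support of a transplant: `transplant ρ z ≠ 0` forces `‖z‖ ≤ ‖reprc z‖ < r` when
`support ρ ⊆ B(0, r)`; in particular `support (transplant ρ) ⊆ B(0, r)` in the torus metric. [folklore] -/
theorem support_transplant_subset {ρ : EuclideanSpace ℝ d → F'} {r : ℝ} (hρ : support ρ ⊆ ball 0 r) :
    support (transplant ρ) ⊆ ball (0 : UnitAddTorus d) r := by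
  intro z hz
  rw [mem_ball_zero_iff]
  by_contra h
  exact hz (transplant_eq_zero_of_le hρ ((not_lt.1 h).trans (norm_le_norm_reprc z)))

end Transplant

/-! ## Smoothness and derivatives of transplanted kernels -/

section TransplantCalculus

variable {F' : Type*} [NormedAddCommGroup F'] [NormedSpace ℝ F']

/-- A transplanted profile is as smooth as the profile (`C^n`), when the profile is supported in
`B(0, 1/4)`: locally its lift is a translate of the profile. [folklore] -/
theorem isContDiff_transplant {n : WithTop ℕ∞} {ρ : EuclideanSpace ℝ d → F'} (hρs : ContDiff ℝ n ρ)
    (hρ : support ρ ⊆ ball 0 (1 / 4)) : IsContDiff n (transplant ρ) := by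
  change ContDiff ℝ n (lift (transplant ρ))
  rw [contDiff_iff_contDiffAt]
  intro y₀
  have h := transplant_proj_eventuallyEq hρ y₀
  refine ContDiffAt.congr_of_eventuallyEq ?_ h
  exact (hρs.comp (contDiff_id.sub contDiff_const)).contDiffAt

/-- A transplanted smooth profile supported in `B(0, 1/4)` is smooth on the torus. [folklore] -/
theorem isSmooth_transplant {ρ : EuclideanSpace ℝ d → F'} (hρs : ContDiff ℝ ∞ ρ)
    (hρ : support ρ ⊆ ball 0 (1 / 4)) : IsSmooth (transplant ρ) :=
  isContDiff_transplant hρs hρ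

/-- The torus Fréchet derivative of a transplant is the derivative of the profile at the centred
representative: `D(transplant ρ) z = Dρ (reprc z)`. [folklore] -/
theorem fderiv_transplant {ρ : EuclideanSpace ℝ d → F'} (hρ : support ρ ⊆ ball 0 (1 / 4))
    (z : UnitAddTorus d) : Torus.fderiv (transplant ρ) z = _root_.fderiv ℝ ρ (reprc z) := by
  have h := fderiv_lift (transplant ρ) (reprc z)
  rw [proj_reprc] at h
  rw [← h]
  exact (lift_transplant_eventuallyEq hρ z).fderiv_eq

/-- The torus gradient of a transplanted scalar profile: `∇(transplant ρ) z = ∇ρ (reprc z)`. [folklore] -/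
theorem gradient_transplant {ρ : EuclideanSpace ℝ d → ℝ} (hρ : support ρ ⊆ ball 0 (1 / 4))
    (z : UnitAddTorus d) : Torus.gradient (transplant ρ) z = _root_.gradient ρ (reprc z) := by
  have h1 : liftAt (transplant ρ) z = lift (transplant ρ) ∘ (reprc z + ·) :=
    liftAt_eq_lift_comp_add _ _ (proj_reprc z)
  have h2 : (lift (transplant ρ) ∘ (reprc z + ·)) =ᶠ[𝓝 0] (ρ ∘ (reprc z + ·)) := by
    have hc : Continuous fun v : EuclideanSpace ℝ d => reprc z + v := continuous_const.add continuous_id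
    have := hc.continuousAt.tendsto.eventually
      (show ∀ᶠ y in 𝓝 (reprc z + 0), lift (transplant ρ) y = ρ y by
        rw [add_zero]; exact lift_transplant_eventuallyEq hρ z)
    exact this
  rw [Torus.gradient, h1, h2.gradient_eq]
  change _root_.gradient (fun v => ρ (reprc z + v)) 0 = _
  rw [_root_.gradient, _root_.gradient, fderiv_comp_add_left, add_zero]

/-- The torus Laplacian of a transplanted profile: `Δ(transplant ρ) z = Δρ (reprc z)`. [folklore] -/
theorem laplacian_transplant {ρ : EuclideanSpace ℝ d → F'} (hρ : support ρ ⊆ ball 0 (1 / 4))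
    (z : UnitAddTorus d) : Torus.laplacian (transplant ρ) z = (Δ ρ) (reprc z) := by
  have h1 : liftAt (transplant ρ) z = lift (transplant ρ) ∘ (reprc z + ·) :=
    liftAt_eq_lift_comp_add _ _ (proj_reprc z)
  have h2 : (lift (transplant ρ) ∘ (reprc z + ·)) =ᶠ[𝓝 0] (ρ ∘ (reprc z + ·)) := by
    have hc : Continuous fun v : EuclideanSpace ℝ d => reprc z + v := continuous_const.add continuous_id
    have := hc.continuousAt.tendsto.eventually
      (show ∀ᶠ y in 𝓝 (reprc z + 0), lift (transplant ρ) y = ρ y by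
        rw [add_zero]; exact lift_transplant_eventuallyEq hρ z)
    exact this
  rw [Torus.laplacian, h1, (InnerProductSpace.laplacian_congr_nhds h2).eq_of_nhds]
  change (Δ (fun v => ρ (reprc z + v))) 0 = _
  rw [InnerProductSpace.laplacian_eq_iteratedFDeriv_stdOrthonormalBasis,
    InnerProductSpace.laplacian_eq_iteratedFDeriv_stdOrthonormalBasis]
  simp only [iteratedFDeriv_comp_add_left, add_zero]

/-- Integral of a transplanted profile supported in `B(0, 1/2)`: `∫_{T^d} transplant ρ = ∫_{ℝ^d} ρ`. [folklore] -/
theorem integral_transplant {ρ : EuclideanSpace ℝ d → F'} (hρ : support ρ ⊆ ball 0 (1 / 2)) :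
    ∫ z, transplant ρ z = ∫ v, ρ v :=
  integral_comp_reprc_of_support_subset hρ

end TransplantCalculus

/-! ## The standard mollifier on `T^d` -/

section Kernel

variable (d) in
/-- A fixed smooth bump on `ℝ^d` centred at `0`, with inner radius `1/2` and outer radius `1`
(Mathlib's `ContDiffBump`; Evans, App. C.4, the profile `η` of the standard mollifier). [folklore] -/
def bumpOne : ContDiffBump (0 : EuclideanSpace ℝ d) := ⟨1 / 2, 1, by norm_num, by norm_num⟩

variable (d) in
/-- The unit-mass profile `ρ₁ = η / ∫ η` on `ℝ^d` (Mathlib's `ContDiffBump.normed`): smooth,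
nonnegative, supported in the unit ball, `∫ ρ₁ = 1` (Evans, App. C.4). [folklore] -/
def profileOne : EuclideanSpace ℝ d → ℝ := (bumpOne d).normed volume

variable (d) in
/-- The constant `C₁ = ∫_{ℝ^d} ‖Dρ₁‖`, which controls `ε ∫ ‖∇ρ_ε‖ = C₁` for the rescaled
profiles (DiPerna–Lions 1989, §II.1, the constant in the commutator estimate). [folklore] -/
def gradProfileMass : ℝ := ∫ v, ‖_root_.fderiv ℝ (profileOne d) v‖

/-- The rescaled profiles `ρ_ε(v) = ε^{-d} ρ₁(ε⁻¹ v)` (Evans, App. C.4, `η_ε`; DiPerna–Lions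
1989, §II.1, `ρ_ε`). This is literally `Fluid.mollifierScale ε (profileOne d)` of
`FluidPDE/DissipationAnomaly` (not importable into `FunctionSpaces/`; see the module
docstring's note for the librarian). [folklore] -/
def profile (ε : ℝ) (v : EuclideanSpace ℝ d) : ℝ :=
  (ε ^ Fintype.card d)⁻¹ * profileOne d (ε⁻¹ • v)

/-- **The standard mollifier on the torus**, `kernel ε = transplant ρ_ε`: for `0 < ε ≤ 1/4`
a smooth nonnegative unit-mass function on `T^d` supported in `{‖z‖ < ε}`
(DiPerna–Lions 1989, §II.1; Evans, App. C.4, Thm. 7). [folklore] -/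
def kernel (ε : ℝ) : UnitAddTorus d → ℝ := transplant (profile ε)

/-! ### The fixed profile -/

/-- `ρ₁` is smooth. [folklore] -/
theorem contDiff_profileOne : ContDiff ℝ ∞ (profileOne d) :=
  (bumpOne d).contDiff_normed

/-- `ρ₁ ≥ 0`. [folklore] -/
theorem profileOne_nonneg (v : EuclideanSpace ℝ d) : 0 ≤ profileOne d v :=
  (bumpOne d).nonneg_normed v

/-- `∫ ρ₁ = 1`. [folklore] -/
theorem integral_profileOne : ∫ v, profileOne d v = 1 :=
  (bumpOne d).integral_normed

/-- `support ρ₁ = B(0, 1)`. [folklore] -/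
theorem support_profileOne : support (profileOne d) = ball 0 1 :=
  (bumpOne d).support_normed_eq

/-- `ρ₁` has compact support. [folklore] -/
theorem hasCompactSupport_profileOne : HasCompactSupport (profileOne d) :=
  (bumpOne d).hasCompactSupport_normed

/-- `Dρ₁` is continuous. [folklore] -/
theorem continuous_fderiv_profileOne : Continuous (_root_.fderiv ℝ (profileOne d)) :=
  contDiff_profileOne.continuous_fderiv (by simp)

/-- `‖Dρ₁‖` is integrable (continuous with compact support). [folklore] -/
theorem integrable_norm_fderiv_profileOne : Integrable (fun v => ‖_root_.fderiv ℝ (profileOne d) v‖) := by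
  exact ((continuous_fderiv_profileOne (d := d)).integrable_of_hasCompactSupport
    (hasCompactSupport_profileOne.fderiv ℝ)).norm

/-- `C₁ ≥ 0`. [folklore] -/
theorem gradProfileMass_nonneg : 0 ≤ gradProfileMass d :=
  integral_nonneg fun _ => norm_nonneg _

/-! ### The rescaled profiles -/

variable {ε : ℝ}

/-- `ρ_ε` is smooth (`ε ≠ 0` is not needed: for `ε = 0` it is the constant `0⁻¹ ρ₁(0)`). [folklore] -/
theorem contDiff_profile (ε : ℝ) : ContDiff ℝ ∞ (profile (d := d) ε) :=
  contDiff_const.mul (contDiff_profileOne.comp (contDiff_const_smul _))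

/-- `ρ_ε ≥ 0` for `0 ≤ ε`. [folklore] -/
theorem profile_nonneg (hε : 0 ≤ ε) (v : EuclideanSpace ℝ d) : 0 ≤ profile ε v :=
  mul_nonneg (inv_nonneg.2 (pow_nonneg hε _)) (profileOne_nonneg _)

/-- `support ρ_ε ⊆ B(0, ε)` for `0 < ε`. [folklore] -/
theorem support_profile_subset (hε : 0 < ε) : support (profile (d := d) ε) ⊆ ball 0 ε := by
  intro v hv
  have h : profileOne d (ε⁻¹ • v) ≠ 0 := fun h => hv (by simp [profile, h])
  have h' : ε⁻¹ • v ∈ ball (0 : EuclideanSpace ℝ d) 1 := by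
    rw [← support_profileOne]; exact h
  rw [mem_ball_zero_iff, norm_smul, norm_inv, Real.norm_eq_abs, abs_of_pos hε,
    inv_mul_lt_iff₀ hε, mul_one] at h'
  exact mem_ball_zero_iff.2 h'

/-- `tsupport ρ_ε ⊆ closedBall 0 ε` for `0 < ε`. [folklore] -/
theorem tsupport_profile_subset (hε : 0 < ε) : tsupport (profile (d := d) ε) ⊆ closedBall 0 ε :=
  (closure_mono (support_profile_subset hε)).trans closure_ball_subset_closedBall

/-- `ρ_ε` has compact support for `0 < ε`. [folklore] -/
theorem hasCompactSupport_profile (hε : 0 < ε) : HasCompactSupport (profile (d := d) ε) :=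
  HasCompactSupport.of_support_subset_isCompact (isCompact_closedBall 0 ε)
    ((support_profile_subset hε).trans ball_subset_closedBall)

/-- `∫ ρ_ε = 1` for `0 < ε` (change of variables `v = ε w`). [folklore] -/
theorem integral_profile (hε : 0 < ε) : ∫ v, profile (d := d) ε v = 1 := by
  simp only [profile]
  rw [MeasureTheory.integral_const_mul, Measure.integral_comp_inv_smul, integral_profileOne,
    finrank_euclideanSpace, abs_of_pos (pow_pos hε _), smul_eq_mul, mul_one,
    inv_mul_cancel₀ (pow_pos hε _).ne']

/-- The derivative of the rescaled profile: `Dρ_ε(v) = ε^{-d} ε⁻¹ Dρ₁(ε⁻¹ v)`. [folklore] -/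
theorem fderiv_profile (ε : ℝ) (v : EuclideanSpace ℝ d) :
    _root_.fderiv ℝ (profile ε) v = ((ε ^ Fintype.card d)⁻¹ * ε⁻¹) • _root_.fderiv ℝ (profileOne d) (ε⁻¹ • v) := by
  have hd : DifferentiableAt ℝ (fun w => profileOne d (ε⁻¹ • w)) v :=
    ((contDiff_profileOne.comp (contDiff_const_smul _)).differentiable (by simp)).differentiableAt
  unfold profile
  rw [fderiv_const_mul hd, mul_smul]
  congr 1
  exact fderiv_comp_smul ε⁻¹

/-- `∫ ‖Dρ_ε‖ = ε⁻¹ C₁` for `0 < ε`. [folklore] -/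
theorem integral_norm_fderiv_profile (hε : 0 < ε) :
    ∫ v, ‖_root_.fderiv ℝ (profile (d := d) ε) v‖ = ε⁻¹ * gradProfileMass d := by
  simp only [fderiv_profile, norm_smul, norm_mul, norm_inv, norm_pow, Real.norm_eq_abs,
    abs_of_pos hε]
  have h := Measure.integral_comp_inv_smul volume (fun w => ‖_root_.fderiv ℝ (profileOne d) w‖) ε
  rw [finrank_euclideanSpace, abs_of_pos (pow_pos hε _), smul_eq_mul] at h
  rw [MeasureTheory.integral_const_mul, h, gradProfileMass]
  field_simp

/-- Outside `closedBall 0 ε` the derivative of `ρ_ε` vanishes (`0 < ε`). [folklore] -/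
theorem fderiv_profile_eq_zero (hε : 0 < ε) {v : EuclideanSpace ℝ d} (hv : ε < ‖v‖) :
    _root_.fderiv ℝ (profile ε) v = 0 := by
  have h : v ∉ tsupport (profile (d := d) ε) := fun h => by
    have := tsupport_profile_subset hε h
    rw [mem_closedBall_zero_iff] at this
    linarith
  rw [notMem_tsupport_iff_eventuallyEq] at h
  rw [h.fderiv_eq, fderiv_zero, Pi.zero_apply]

/-- The support of `Dρ_ε` lies in `closedBall 0 ε` (`0 < ε`). [folklore] -/
theorem support_fderiv_profile_subset (hε : 0 < ε) :
    support (_root_.fderiv ℝ (profile (d := d) ε)) ⊆ closedBall 0 ε := fun v hv => by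
  by_contra h
  exact hv (fderiv_profile_eq_zero hε (not_le.1 fun h' => h (mem_closedBall_zero_iff.2 h')))

/-! ### The torus kernel -/

/-- For `0 < ε ≤ 1/4` the profile is supported in `B(0, 1/4)`. [folklore] -/
theorem support_profile_subset_quarter (hε : 0 < ε) (hε' : ε ≤ 1 / 4) :
    support (profile (d := d) ε) ⊆ ball 0 (1 / 4) :=
  (support_profile_subset hε).trans (ball_subset_ball hε')

/-- The torus kernel is smooth (`0 < ε ≤ 1/4`). [folklore] -/
theorem isSmooth_kernel (hε : 0 < ε) (hε' : ε ≤ 1 / 4) : IsSmooth (kernel (d := d) ε) :=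
  isSmooth_transplant (contDiff_profile ε) (support_profile_subset_quarter hε hε')

/-- The torus kernel is continuous (`0 < ε ≤ 1/4`). [folklore] -/
theorem continuous_kernel (hε : 0 < ε) (hε' : ε ≤ 1 / 4) : Continuous (kernel (d := d) ε) :=
  (isSmooth_kernel hε hε').continuous

/-- The torus kernel is nonnegative (`0 ≤ ε`). [folklore] -/
theorem kernel_nonneg (hε : 0 ≤ ε) (z : UnitAddTorus d) : 0 ≤ kernel ε z :=
  profile_nonneg hε _

/-- The torus kernel has unit mass (`0 < ε ≤ 1/4`). [folklore] -/
theorem integral_kernel (hε : 0 < ε) (hε' : ε ≤ 1 / 4) : ∫ z, kernel (d := d) ε z = 1 := by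
  unfold kernel
  rw [integral_transplant ((support_profile_subset hε).trans (ball_subset_ball (by linarith))),
    integral_profile hε]

/-- The torus kernel is supported in the ball `{‖z‖ < ε}` (`0 < ε`). [folklore] -/
theorem support_kernel_subset (hε : 0 < ε) : support (kernel (d := d) ε) ⊆ ball 0 ε :=
  support_transplant_subset (support_profile_subset hε)

/-- `kernel ε z = 0` when `ε ≤ ‖z‖` (`0 < ε`). [folklore] -/
theorem kernel_eq_zero_of_le (hε : 0 < ε) {z : UnitAddTorus d} (hz : ε ≤ ‖z‖) : kernel ε z = 0 := by
  by_contra h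
  exact (mem_ball_zero_iff.1 (support_kernel_subset hε h)).not_ge hz

/-- The gradient of the torus kernel is the gradient of the profile at the centred
representative (`0 < ε ≤ 1/4`). [folklore] -/
theorem gradient_kernel (hε : 0 < ε) (hε' : ε ≤ 1 / 4) (z : UnitAddTorus d) :
    Torus.gradient (kernel ε) z = _root_.gradient (profile ε) (reprc z) :=
  gradient_transplant (support_profile_subset_quarter hε hε') z

/-- `‖∇ kernel ε z‖ = ‖Dρ_ε (reprc z)‖` (`0 < ε ≤ 1/4`). [folklore] -/
theorem norm_gradient_kernel (hε : 0 < ε) (hε' : ε ≤ 1 / 4) (z : UnitAddTorus d) :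
    ‖Torus.gradient (kernel ε) z‖ = ‖_root_.fderiv ℝ (profile ε) (reprc z)‖ := by
  rw [gradient_kernel hε hε', _root_.gradient, LinearIsometryEquiv.norm_map]

/-- The gradient of the torus kernel vanishes outside `{‖z‖ ≤ ε}` (`0 < ε ≤ 1/4`). [folklore] -/
theorem gradient_kernel_eq_zero (hε : 0 < ε) (hε' : ε ≤ 1 / 4) {z : UnitAddTorus d}
    (hz : ε < ‖z‖) : Torus.gradient (kernel ε) z = 0 := by
  rw [← norm_eq_zero, norm_gradient_kernel hε hε',
    fderiv_profile_eq_zero hε (hz.trans_le (norm_le_norm_reprc z)), norm_zero]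

/-- Where the gradient of the torus kernel is nonzero, `‖z‖ ≤ ε` (`0 < ε ≤ 1/4`). [folklore] -/
theorem norm_le_of_gradient_kernel_ne_zero (hε : 0 < ε) (hε' : ε ≤ 1 / 4) {z : UnitAddTorus d}
    (hz : Torus.gradient (kernel ε) z ≠ 0) : ‖z‖ ≤ ε :=
  not_lt.1 fun h => hz (gradient_kernel_eq_zero hε hε' h)

/-- The gradient of the torus kernel is continuous (`0 < ε ≤ 1/4`). [folklore] -/
theorem continuous_gradient_kernel (hε : 0 < ε) (hε' : ε ≤ 1 / 4) :
    Continuous (Torus.gradient (kernel (d := d) ε)) :=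
  (isSmooth_kernel hε hε').gradient.continuous

/-- **`ε ∫ ‖∇ kernel ε‖ = C₁`**: `∫_{T^d} ‖∇ kernel ε‖ = ε⁻¹ C₁` (`0 < ε ≤ 1/4`; the integral
over the torus is the integral of `‖Dρ_ε‖` over `ℝ^d`, and `Dρ_ε(v) = ε^{-d-1} Dρ₁(v/ε)`). [folklore] -/
theorem integral_norm_gradient_kernel (hε : 0 < ε) (hε' : ε ≤ 1 / 4) :
    ∫ z, ‖Torus.gradient (kernel (d := d) ε) z‖ = ε⁻¹ * gradProfileMass d := by
  simp_rw [norm_gradient_kernel hε hε']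
  rw [integral_comp_reprc_of_support_subset (g := fun v => ‖_root_.fderiv ℝ (profile (d := d) ε) v‖),
    integral_norm_fderiv_profile hε]
  intro v hv
  have h : _root_.fderiv ℝ (profile (d := d) ε) v ≠ 0 := fun h => hv (by simp [h])
  have := support_fderiv_profile_subset hε h
  rw [mem_closedBall_zero_iff] at this
  exact mem_ball_zero_iff.2 (by linarith)

/-- `lintegral` form: `∫⁻ ‖∇ kernel ε‖ₑ = ENNReal.ofReal (ε⁻¹ C₁)` (`0 < ε ≤ 1/4`). [folklore] -/
theorem lintegral_enorm_gradient_kernel (hε : 0 < ε) (hε' : ε ≤ 1 / 4) :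
    ∫⁻ z, ‖Torus.gradient (kernel (d := d) ε) z‖ₑ = ENNReal.ofReal (ε⁻¹ * gradProfileMass d) := by
  rw [← ofReal_integral_norm_eq_lintegral_enorm
    (continuous_gradient_kernel hε hε').integrable_unitAddTorus, integral_norm_gradient_kernel hε hε']

/-- `lintegral` form of the unit mass: `∫⁻ ‖kernel ε‖ₑ = 1` (`0 < ε ≤ 1/4`). [folklore] -/
theorem lintegral_enorm_kernel (hε : 0 < ε) (hε' : ε ≤ 1 / 4) :
    ∫⁻ z, ‖kernel (d := d) ε z‖ₑ = 1 := by
  have h : ∫ z, ‖kernel (d := d) ε z‖ = ∫ z, kernel (d := d) ε z :=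
    integral_congr_ae (Eventually.of_forall fun z => by
      simp [Real.norm_eq_abs, abs_of_nonneg (kernel_nonneg hε.le z)])
  rw [← ofReal_integral_norm_eq_lintegral_enorm (continuous_kernel hε hε').integrable_unitAddTorus,
    h, integral_kernel hε hε', ENNReal.ofReal_one]

end Kernel

end Torus

end Literature.Analysis.FunctionSpaces
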